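import Summits.Ventures.PercRepro.ProfilePointedCircuitClassesStarNineSplitF

/-!
# PercRepro — THE TWO-PART SPLIT OF THE DEFECT BOUND, PART G: REGIME E AWAY FROM `f`
(p5, gen 58; `proofs/P5-GM1.md` §86 ADD 4)

Part C's injection of the first-kind defects into the `C`-pairs used the hypothesis «`e ∉ cl A` for every `3`-set
`A ⊆ E − e`» only on the `3`-set `X − τ₁ − τ₂ ⊆ X` (`mem_clF_of_two_tTwo`).  So the same argument gives (★)₉ under the
weaker hypothesis **`e ∉ cl A` for every `3`-set `A ⊆ X = E − e − f`** — `e` lies in no circuit of size `≤ 4` that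
AVOIDS `f` (the `4`-circuits `{e, f, z₁, z₂}`, the killers of ADD 2, and the `3`-circuits `{e, f, x}` are now allowed):
`card_tTwo_le_card_cPairs_of_eFreeX`, `inCount_le_of_eFreeX`.  This is REGIME E⁺; it contains regime E, and together with
regime EF3 (part D) it covers 94 % of the core instances (kit j337688).
-/

open scoped Matroid

namespace PercRepro.Cogirth

open Finset ThmH Skew Shadow Profile

open Classical

variable {α : Type} [DecidableEq α] {N : Matroid α} [N.Finite]

section StarNineSplitG

/-- **REGIME E⁺ — THE FIRST-KIND DEFECTS INJECT INTO THE `C`-PAIRS** when `e ∉ cl A` for every `3`-set `A ⊆ X`. -/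
theorem card_tTwo_le_card_cPairs_of_eFreeX (hn : (gr N).card = 9)
    (hsimple : ∀ x ∈ gr N, ∀ y ∈ gr N, x ≠ y → rk N {x, y} = 2)
    (hcos : ∀ x ∈ gr N, ∀ y ∈ gr N, x ≠ y → rk N (((gr N).erase x).erase y) = 5) {e f : α} (he : e ∈ gr N)
    (hf : f ∈ gr N) (hef : e ≠ f) (hT : ∀ A ⊆ ((gr N).erase e).erase f, A.card = 3 → e ∉ clF N A) :
    (tTwo N e f).card ≤ (cPairs N e f).card := by
  apply card_le_card_of_forall_subsingleton (fun (τ π : Finset α) => π ⊆ τ)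
  · intro τ hτ
    have hτ' := hτ
    unfold tTwo at hτ'
    rw [mem_filter] at hτ'
    obtain ⟨hτD, _⟩ := hτ'
    obtain ⟨hτX, hτ3, _, _, _, _, hnot⟩ := edefect_facts hn he hf hef hτD
    have hbi : insert e τ ∈ biIndepSets N 4 := by
      have := (mem_sdiff.1 hτD).1
      unfold defTriples at this
      rw [mem_filter] at this
      exact this.2
    obtain ⟨π, hπτ, hπ2, hπbi⟩ := cpair_of_defect hn hsimple hcos he hf hef hτX hτ3 hbi hnot
    refine ⟨π, ?_, hπτ⟩
    unfold cPairs
    rw [mem_filter, mem_powersetCard]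
    exact ⟨⟨hπτ.trans hτX, hπ2⟩, hπbi⟩
  · intro π hπ τ₁ hτ₁ τ₂ hτ₂
    simp only [Set.mem_setOf_eq] at hτ₁ hτ₂
    by_contra hne
    obtain ⟨hcl, hcard⟩ := mem_clF_of_two_tTwo hn he hf hef hπ hτ₁.1 hτ₂.1 hτ₁.2 hτ₂.2 hne
    exact hT _ sdiff_subset hcard hcl

/-- **REGIME E⁺ — (★)₉**: on a simple cosimple `N` with `#E = 9`, `in_4(e) ≤ in_4(f) + thru_4({e, f})` whenever `e` lies
in no circuit of size `≤ 4` avoiding `f` (`e ∉ cl A` for every `3`-set `A ⊆ E − e − f`). -/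
theorem inCount_le_of_eFreeX (hn : (gr N).card = 9)
    (hsimple : ∀ x ∈ gr N, ∀ y ∈ gr N, x ≠ y → rk N {x, y} = 2)
    (hcos : ∀ x ∈ gr N, ∀ y ∈ gr N, x ≠ y → rk N (((gr N).erase x).erase y) = 5) {e f : α} (he : e ∈ gr N)
    (hf : f ∈ gr N) (hef : e ≠ f) (hT : ∀ A ⊆ ((gr N).erase e).erase f, A.card = 3 → e ∉ clF N A) :
    inCount N 4 e ≤ inCount N 4 f + thruCount N 4 {e, f} := by
  apply starNine_of_defect_bound hef
  apply defect_bound_of_tTwo_bound hn hsimple hcos he hf hef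
  have := card_tTwo_le_card_cPairs_of_eFreeX hn hsimple hcos he hf hef hT
  omega

end StarNineSplitG

end PercRepro.Cogirth
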